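import Mathlib
import Literature.NumberTheory.Transcendental.KZPeriodsProofs
import Summits.KontsevichZagierPeriods.KontsevichZagierPeriods.Theorems.LogPrimitiveNL.Negative.BakerRelationSpan
import Summits.KontsevichZagierPeriods.KontsevichZagierPeriods.Theorems.LogPrimitiveNL.Negative.DimZero

/-!
# `TateFamilyKernelCurves` (stmt-KontsevichZagierPeriods-9132), line `Sketch` — stub `stub_bakerSplitting`

Baker splitting. An identity `γ + Σᵢ hᵢ log uᵢ + Σⱼ βⱼ (arctan xⱼ − arctan yⱼ) = 0` with all data
real algebraic (`uᵢ > 0`) SPLITS: `γ = 0`, `Σᵢ hᵢ log uᵢ = 0`, and the angle weight vector `β` is a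
real-algebraic combination of INTEGER vectors that are exact relations among the angles
`θⱼ = arctan xⱼ − arctan yⱼ`.

Proof. With the logarithms of algebraic numbers `Lᵢ = log uᵢ` (`exp Lᵢ = uᵢ`) and
`Λⱼ = log((1 + xⱼ i)/(1 − xⱼ i)) − log((1 + yⱼ i)/(1 − yⱼ i))` one has `θⱼ = −(i/2) Λⱼ`
(`Complex.ofReal_arctan`: `arctan t = −(i/2) log((1 + t i)/(1 − t i))`), so the hypothesis is the
`ℚ̄`-linear relation `Σ hᵢ Lᵢ + Σ (−i βⱼ/2) Λⱼ = −γ`. Baker's theorem in the inhomogeneous form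
`baker_sum_eq_zero` (tree, from `baker_holds`) gives `γ = 0`; in the relation-span form
`baker_relation_span_int` it writes the coefficient vector as a `ℚ̄`-combination `Σᵣ c'ᵣ mᵣ` of
INTEGER relations `Σ mᵣᵢ Lᵢ + Σ mᵣⱼ Λⱼ = 0`, whose imaginary parts are the integer angle relations
`Σⱼ mᵣⱼ θⱼ = 0` (`Im Lᵢ = 0`, `Im Λⱼ = 2θⱼ`). From `−i βⱼ/2 = Σᵣ c'ᵣ mᵣⱼ` we get
`βⱼ = Σᵣ Re(2 i c'ᵣ) mᵣⱼ` with real-algebraic coefficients (`isAlgebraic_re_im`), hence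
`Σ βⱼ θⱼ = 0` and the modulus total `Σ hᵢ log uᵢ = −γ − Σ βⱼ θⱼ` vanishes.
-/

noncomputable section

open Complex
open Literature.NumberTheory.Transcendental
open Summit.KontsevichZagierPeriods.LiouvilleUnfolding.LogPrimitiveNL.Negative
  (baker_sum_eq_zero baker_relation_span_int)

namespace Summit.KontsevichZagierPeriods.InverseLandau

/-- `i` is algebraic over `ℚ` (`i² + 1 = 0`). [folklore] -/
theorem bs_isAlgebraic_I : IsAlgebraic ℚ Complex.I := by
  refine ⟨Polynomial.X ^ 2 + 1, Polynomial.Monic.ne_zero (by monicity!), ?_⟩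
  simp

/-- A quotient of algebraic numbers is algebraic. [folklore] -/
theorem bs_isAlgebraic_div {a b : ℂ} (ha : IsAlgebraic ℚ a) (hb : IsAlgebraic ℚ b) :
    IsAlgebraic ℚ (a / b) := by
  rw [div_eq_mul_inv]
  exact ha.mul hb.inv

/-- For real `t`, `1 + t i ≠ 0` and `1 - t i ≠ 0` (their real part is `1`). [folklore] -/
theorem bs_one_add_mul_I_ne_zero (t : ℝ) : (1 + t * I : ℂ) ≠ 0 ∧ (1 - t * I : ℂ) ≠ 0 := by
  constructor <;> intro h <;> simpa using congrArg Complex.re h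

/-- For real algebraic `t`, the Cayley transform `(1 + t i)/(1 − t i)` is algebraic and non-zero.
[folklore] -/
theorem bs_cayley_isAlgebraic {t : ℝ} (ht : IsAlgebraic ℚ t) :
    IsAlgebraic ℚ ((1 + t * I) / (1 - t * I) : ℂ) ∧ ((1 + t * I) / (1 - t * I) : ℂ) ≠ 0 := by
  have htC : IsAlgebraic ℚ (t : ℂ) := ht.algebraMap
  obtain ⟨h1, h2⟩ := bs_one_add_mul_I_ne_zero t
  exact ⟨bs_isAlgebraic_div (isAlgebraic_one.add (htC.mul bs_isAlgebraic_I))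
    (isAlgebraic_one.sub (htC.mul bs_isAlgebraic_I)), div_ne_zero h1 h2⟩

/-- `arctan t = −(i/2) · log((1 + t i)/(1 − t i))` for real `t` (Mathlib's `Complex.arctan` and
`Complex.ofReal_arctan`). [folklore] -/
theorem bs_ofReal_arctan (t : ℝ) :
    (Real.arctan t : ℂ) = -I / 2 * Complex.log ((1 + t * I) / (1 - t * I)) := by
  rw [Complex.ofReal_arctan, Complex.arctan]

/-- **S3 (Baker splitting).** An identity `γ + Σᵢ hᵢ log uᵢ + Σⱼ βⱼ (arctan xⱼ − arctan yⱼ) = 0`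
with all data real algebraic (`uᵢ > 0`) SPLITS: `γ = 0`, `Σ hᵢ log uᵢ = 0`, and `β` is a
real-algebraic combination of INTEGER vectors that are exact relations among the angles
`arctan xⱼ − arctan yⱼ`.
From `baker_sum_eq_zero` and `baker_relation_span_int` (tree, from `baker_holds`) applied to the
logarithms `log uᵢ` and `log((1 + xⱼ i)/(1 − xⱼ i)) − log((1 + yⱼ i)/(1 − yⱼ i)) = 2i θⱼ`; the
integer angle relations are the imaginary parts of Baker's integer relations.
[cite: Baker1975, Thm 2.1] -/
theorem stub_bakerSplitting : ∀ (m₁ m₂ : ℕ) (γ : ℝ) (h u : Fin m₁ → ℝ) (β x y : Fin m₂ → ℝ),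
    IsAlgebraic ℚ γ → (∀ i, IsAlgebraic ℚ (h i) ∧ IsAlgebraic ℚ (u i) ∧ 0 < u i) →
    (∀ j, IsAlgebraic ℚ (β j) ∧ IsAlgebraic ℚ (x j) ∧ IsAlgebraic ℚ (y j)) →
    γ + ∑ i, h i * Real.log (u i) + ∑ j, β j * (Real.arctan (x j) - Real.arctan (y j)) = 0 →
    γ = 0 ∧ ∑ i, h i * Real.log (u i) = 0 ∧
      ∃ (R : ℕ) (n : Fin R → Fin m₂ → ℤ) (c : Fin R → ℝ), (∀ k, IsAlgebraic ℚ (c k)) ∧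
        (∀ k, ∑ j, (n k j : ℝ) * (Real.arctan (x j) - Real.arctan (y j)) = 0) ∧
        ∀ j, β j = ∑ k, c k * n k j := by
  intro m₁ m₂ γ h u β x y hγ hhu hβxy hrel
  -- the angles `θⱼ`
  obtain ⟨θ, hθ⟩ : ∃ θ : Fin m₂ → ℝ, ∀ j, Real.arctan (x j) - Real.arctan (y j) = θ j :=
    ⟨_, fun _ => rfl⟩
  simp only [hθ] at hrel ⊢
  -- the logarithms of algebraic numbers `Lᵢ`, `Λⱼ`
  obtain ⟨L, hL⟩ : ∃ L : Fin m₁ → ℂ, ∀ i, L i = ((Real.log (u i) : ℝ) : ℂ) := ⟨_, fun _ => rfl⟩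
  obtain ⟨Λ, hΛ⟩ : ∃ Λ : Fin m₂ → ℂ, ∀ j, Λ j = Complex.log ((1 + x j * I) / (1 - x j * I)) -
      Complex.log ((1 + y j * I) / (1 - y j * I)) := ⟨_, fun _ => rfl⟩
  have hθΛ : ∀ j, ((θ j : ℝ) : ℂ) = -I / 2 * Λ j := fun j => by
    rw [← hθ j, hΛ j, Complex.ofReal_sub, bs_ofReal_arctan, bs_ofReal_arctan]
    ring
  have hΛim : ∀ j, (Λ j).im = 2 * θ j := fun j => by
    have e : Λ j = 2 * I * ((θ j : ℝ) : ℂ) := by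
      rw [hθΛ j]
      linear_combination (Λ j) * Complex.I_mul_I
    rw [e]
    simp
  have hLim : ∀ i, (L i).im = 0 := fun i => by
    rw [hL i]
    exact Complex.ofReal_im _
  have hexpL : ∀ i, IsAlgebraic ℚ (cexp (L i)) := fun i => by
    rw [hL i, ← Complex.ofReal_exp, Real.exp_log (hhu i).2.2]
    exact (hhu i).2.1.algebraMap
  have hexpΛ : ∀ j, IsAlgebraic ℚ (cexp (Λ j)) := fun j => by
    obtain ⟨hxa, hx0⟩ := bs_cayley_isAlgebraic (hβxy j).2.1
    obtain ⟨hya, hy0⟩ := bs_cayley_isAlgebraic (hβxy j).2.2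
    rw [hΛ j, Complex.exp_sub, Complex.exp_log hx0, Complex.exp_log hy0]
    exact bs_isAlgebraic_div hxa hya
  -- the family indexed by `Fin (m₁ + m₂)` and its coefficient vector
  obtain ⟨l, hl₁, hl₂⟩ : ∃ l : Fin (m₁ + m₂) → ℂ,
      (∀ i, l (Fin.castAdd m₂ i) = L i) ∧ ∀ j, l (Fin.natAdd m₁ j) = Λ j :=
    ⟨Fin.append L Λ, fun i => Fin.append_left L Λ i, fun j => Fin.append_right L Λ j⟩
  obtain ⟨c, hc₁, hc₂⟩ : ∃ c : Fin (m₁ + m₂) → ℂ,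
      (∀ i, c (Fin.castAdd m₂ i) = ((h i : ℝ) : ℂ)) ∧
        ∀ j, c (Fin.natAdd m₁ j) = -I / 2 * ((β j : ℝ) : ℂ) :=
    ⟨Fin.append (fun i => ((h i : ℝ) : ℂ)) (fun j => -I / 2 * ((β j : ℝ) : ℂ)),
      fun i => Fin.append_left _ _ i, fun j => Fin.append_right _ _ j⟩
  have hlalg : ∀ i, IsAlgebraic ℚ (cexp (l i)) := fun i => by
    refine Fin.addCases (fun i => ?_) (fun j => ?_) i
    · rw [hl₁]
      exact hexpL i
    · rw [hl₂]
      exact hexpΛ j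
  have hI2 : IsAlgebraic ℚ (-I / 2 : ℂ) :=
    bs_isAlgebraic_div bs_isAlgebraic_I.neg (isAlgebraic_nat 2)
  have hcalg : ∀ i, IsAlgebraic ℚ (c i) := fun i => by
    refine Fin.addCases (fun i => ?_) (fun j => ?_) i
    · rw [hc₁]
      exact (hhu i).1.algebraMap
    · rw [hc₂]
      exact hI2.mul (hβxy j).1.algebraMap
  -- the hypothesis as a `ℚ̄`-linear relation among the logarithms
  have hrelC : ((γ : ℝ) : ℂ) + ∑ i, ((h i : ℝ) : ℂ) * ((Real.log (u i) : ℝ) : ℂ) +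
      ∑ j, ((β j : ℝ) : ℂ) * ((θ j : ℝ) : ℂ) = 0 := by
    have e := congrArg Complex.ofReal hrel
    simpa only [Complex.ofReal_add, Complex.ofReal_sum, Complex.ofReal_mul,
      Complex.ofReal_zero] using e
  have hsum : ∑ i, c i * l i = -((γ : ℝ) : ℂ) := by
    rw [Fin.sum_univ_add]
    simp only [hl₁, hl₂, hc₁, hc₂, hL]
    have e : ∀ j, -I / 2 * ((β j : ℝ) : ℂ) * Λ j = ((β j : ℝ) : ℂ) * ((θ j : ℝ) : ℂ) :=
      fun j => by rw [hθΛ j]; ring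
    simp only [e]
    linear_combination hrelC
  -- (1) Baker, inhomogeneous form: `γ = 0`
  have hγ0 : γ = 0 := by
    have e := baker_sum_eq_zero l c (-((γ : ℝ) : ℂ)) hlalg hcalg hγ.algebraMap.neg hsum
    exact_mod_cast neg_eq_zero.mp e
  -- (2) Baker, relation-span form
  have hsum0 : ∑ i, c i * l i = 0 := by
    rw [hsum, hγ0, Complex.ofReal_zero, neg_zero]
  obtain ⟨R, m, c', hc'alg, hm, hcm⟩ := baker_relation_span_int l c hlalg hcalg hsum0
  -- the integer angle relations: imaginary parts of Baker's integer relations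
  have hn : ∀ r, ∑ j, ((m r (Fin.natAdd m₁ j) : ℤ) : ℝ) * θ j = 0 := fun r => by
    have h0 := hm r
    rw [Fin.sum_univ_add] at h0
    simp only [hl₁, hl₂] at h0
    have h1 := congrArg Complex.im h0
    simp only [Complex.add_im, Complex.im_sum, Complex.mul_im, Complex.intCast_re,
      Complex.intCast_im, hLim, hΛim, zero_mul, mul_zero, add_zero, Finset.sum_const_zero,
      zero_add, Complex.zero_im] at h1
    have e : ∑ j, ((m r (Fin.natAdd m₁ j) : ℤ) : ℝ) * θ j =
        (1 / 2) * ∑ j, ((m r (Fin.natAdd m₁ j) : ℤ) : ℝ) * (2 * θ j) := by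
      rw [Finset.mul_sum]
      exact Finset.sum_congr rfl fun j _ => by ring
    rw [e, h1, mul_zero]
  -- the coefficients `Re (2 i c'ᵣ)`
  obtain ⟨d, hd⟩ : ∃ d : Fin R → ℂ, ∀ r, d r = 2 * I * c' r := ⟨_, fun _ => rfl⟩
  have hdalg : ∀ r, IsAlgebraic ℚ (d r).re := fun r => by
    have e : IsAlgebraic ℚ (d r) := by
      rw [hd r]
      exact ((isAlgebraic_nat 2).mul bs_isAlgebraic_I).mul (hc'alg r)
    exact (isAlgebraic_re_im e).1
  have hβC : ∀ j, ((β j : ℝ) : ℂ) = ∑ r, d r * ((m r (Fin.natAdd m₁ j) : ℤ) : ℂ) := fun j => by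
    have h1 := hcm (Fin.natAdd m₁ j)
    rw [hc₂] at h1
    have e : ∑ r, d r * ((m r (Fin.natAdd m₁ j) : ℤ) : ℂ) =
        2 * I * ∑ r, c' r * ((m r (Fin.natAdd m₁ j) : ℤ) : ℂ) := by
      rw [Finset.mul_sum]
      exact Finset.sum_congr rfl fun r _ => by rw [hd r]; ring
    rw [e, ← h1]
    linear_combination ((β j : ℝ) : ℂ) * Complex.I_mul_I
  have hβ : ∀ j, β j = ∑ r, (d r).re * ((m r (Fin.natAdd m₁ j) : ℤ) : ℝ) := fun j => by
    have h1 := congrArg Complex.re (hβC j)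
    simpa only [Complex.ofReal_re, Complex.re_sum, Complex.mul_re, Complex.intCast_re,
      Complex.intCast_im, mul_zero, sub_zero] using h1
  -- (3) the angle total, hence the modulus total, vanishes
  have hβθ : ∑ j, β j * θ j = 0 := by
    calc ∑ j, β j * θ j
        = ∑ j, ∑ r, (d r).re * (((m r (Fin.natAdd m₁ j) : ℤ) : ℝ) * θ j) := by
          refine Finset.sum_congr rfl fun j _ => ?_
          rw [hβ j, Finset.sum_mul]
          exact Finset.sum_congr rfl fun r _ => by ring
      _ = ∑ r, (d r).re * ∑ j, ((m r (Fin.natAdd m₁ j) : ℤ) : ℝ) * θ j := by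
          rw [Finset.sum_comm]
          exact Finset.sum_congr rfl fun r _ => by rw [Finset.mul_sum]
      _ = 0 := by simp [hn]
  refine ⟨hγ0, ?_, R, fun r j => m r (Fin.natAdd m₁ j), fun r => (d r).re, hdalg, hn, hβ⟩
  rw [hγ0, hβθ, zero_add, add_zero] at hrel
  exact hrel

end Summit.KontsevichZagierPeriods.InverseLandau

end
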